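import Summits.NavierStokesRegularity.NavierStokesRegularity.Theorems.ExtremiserTransienceKStarAttainedDensity
import Summits.NavierStokesRegularity.NavierStokesRegularity.Theorems.ExtremiserTransienceLocalMaximiserGainLimit
import HarnessLib

/-!
# Route `ExtremiserTransience`, crux `NearExtremalTransiencePerFlow` (stmt-NavierStokesRegularity-26567):
# the VARIATIONAL CALCULUS of the local gain — Taylor coefficients, cubic structure, two-sided tests off the contact set
# (Theorems-side PORT of LINE g9-1 «local_maximiser» §3b–§3c, ns-idea-10 g9, PROVED there; needed BY NAME by LINE g10-1
# «two_thirds» stub S2 `FirstOrderIdentity`)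

This file is a verbatim port (namespace and three lemma names adapted: `gi` ↦ the landed `gainIntegrand`, `continuous_sd` ↦
`continuous_sd'`, `sd_congr` ↦ `sd_congr_nhds`) of the kernel-checked §3b «Taylor coefficients of the local gain» and §3c «two-sided
tests off the contact set» of `Cruxes/NearExtremalTransience/Lines/local_maximiser.lean` REV 3.8 (ns-idea-10 g9 — all credit there),
so that Theorems files (which may not import a `Cruxes/` skeleton) can use them:

* densities `c1 c2 c3 z1 w1`, Taylor coefficients `a1 a2 a3` of `s ↦ locGain κ μ V (s•φ)`, the pointwise cubic expansion
  `gainIntegrand_smul` and the CUBIC STRUCTURE `locGain_smul : locGain κ μ V (s•φ) = s·a₁ + s²·a₂ + s³·a₃`;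
* weighted bulks `Jg`, `Kg` and `Kg_pos`; `coeff2_nonpos`, `coeff1_nonpos`, `coeff2_nonpos'`;
* `isDivFree_const_smul`, `isTest_smul_of_strict`, `isLocMax_of_isLocMaxIn`, and FIRST AND SECOND ORDER OFF THE CONTACT SET
  `firstSecondOrder_of_strict` (`a₁ = 0 ∧ a₂ ≤ 0` along directions supported in `{‖V‖ < 1}`), `eulerLagrange_dim`.

HONEST FRAMING: calculus lemmas about smooth vector fields; nothing about Navier–Stokes regularity or blow-up is proved; the crux
⟨26567⟩ and NS regularity are OPEN; no summit is proved by a line. [folklore]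
-/

noncomputable section

open scoped Topology InnerProductSpace RealInnerProductSpace ENNReal ContDiff
open MeasureTheory Filter Set
open Literature.Analysis.FluidPDE
open Summit.NavierStokesRegularity.NavierStokesRegularity.Theorems.DepletionLadder.KStar.HalfSpace
open Summit.NavierStokesRegularity.NavierStokesRegularity.Theorems.DepletionLadder.KStar.BangBang
open Summit.NavierStokesRegularity.NavierStokesRegularity.Theorems.DepletionLadder

namespace Summit.NavierStokesRegularity.NavierStokesRegularity.Theorems.NearExtremalTransiencePerFlow.LocalMaximiser

-- the summit's namespace repeats the problem name by convention (D-0017)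
set_option linter.dupNamespace false

variable {κ μ : ℝ} {V φ : E3 → E3}

/-! ## Taylor coefficients of the local gain (port of §3b) -/

/-- first-order stretching coefficient density. -/
def c1 (V φ : E3 → E3) (x : E3) : ℝ :=
  ⟪curl φ x, fderiv ℝ V x (curl V x)⟫_ℝ + ⟪curl V x, fderiv ℝ φ x (curl V x)⟫_ℝ + ⟪curl V x, fderiv ℝ V x (curl φ x)⟫_ℝ
/-- second-order stretching coefficient density. -/
def c2 (V φ : E3 → E3) (x : E3) : ℝ :=
  ⟪curl φ x, fderiv ℝ φ x (curl V x)⟫_ℝ + ⟪curl φ x, fderiv ℝ V x (curl φ x)⟫_ℝ + ⟪curl V x, fderiv ℝ φ x (curl φ x)⟫_ℝ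
/-- third-order stretching coefficient density (the stretching density of `φ` itself). -/
def c3 (φ : E3 → E3) (x : E3) : ℝ := ⟪curl φ x, fderiv ℝ φ x (curl φ x)⟫_ℝ
/-- first-order enstrophy coefficient density `⟪ω, curl φ⟫`. -/
def z1 (V φ : E3 → E3) (x : E3) : ℝ := ⟪curl V x, curl φ x⟫_ℝ
/-- first-order palinstrophy coefficient density `Σᵢ ⟪∂ᵢω, ∂ᵢ curl φ⟫`. -/
def w1 (V φ : E3 → E3) (x : E3) : ℝ :=
  ∑ i, ⟪fderiv ℝ (curl V) x (EuclideanSpace.basisFun (Fin 3) ℝ i), fderiv ℝ (curl φ) x (EuclideanSpace.basisFun (Fin 3) ℝ i)⟫_ℝ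

/-- FIRST TAYLOR COEFFICIENT (first variation) of `s ↦ locGain κ μ V (s•φ)`. -/
def a1 (κ μ : ℝ) (V φ : E3 → E3) : ℝ :=
  ∫ x, (c1 V φ x - (κ / 2) * (μ⁻¹ * (2 * z1 V φ x) + μ * (2 * w1 V φ x)))
/-- SECOND TAYLOR COEFFICIENT (half the second variation) of `s ↦ locGain κ μ V (s•φ)`. -/
def a2 (κ μ : ℝ) (V φ : E3 → E3) : ℝ :=
  ∫ x, (c2 V φ x - (κ / 2) * (μ⁻¹ * zd φ x + μ * wd φ x))
/-- THIRD TAYLOR COEFFICIENT of `s ↦ locGain κ μ V (s•φ)` (independent of `κ, μ, V` except through nothing: it is `J(φ)`-like). -/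
def a3 (φ : E3 → E3) : ℝ := ∫ x, c3 φ x

/-- Pointwise cubic expansion of the gain integrand along `s ↦ V + s•φ`. [folklore] -/
theorem gainIntegrand_smul (hV : ContDiff ℝ (⊤ : ℕ∞) V) (hφ : ContDiff ℝ (⊤ : ℕ∞) φ) (s : ℝ) (x : E3) :
    gainIntegrand κ μ V (s • φ) x =
      s * (c1 V φ x - (κ / 2) * (μ⁻¹ * (2 * z1 V φ x) + μ * (2 * w1 V φ x))) +
        s ^ 2 * (c2 V φ x - (κ / 2) * (μ⁻¹ * zd φ x + μ * wd φ x)) + s ^ 3 * c3 φ x := by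
  have hW : V + s • φ = fun y => V y + s • φ y := rfl
  have hVd : Differentiable ℝ V := hV.differentiable (by simp)
  have hφd : Differentiable ℝ φ := hφ.differentiable (by simp)
  have e1 : curl (V + s • φ) x = curl V x + s • curl φ x := by
    rw [hW, KStar.curl_add_smul hVd hφd]
  have e2 : fderiv ℝ (V + s • φ) x = fderiv ℝ V x + s • fderiv ℝ φ x := by
    rw [hW]; exact KStar.fderiv_add_smul hVd hφd s x
  have e3 : fderiv ℝ (curl (V + s • φ)) x = fderiv ℝ (curl V) x + s • fderiv ℝ (curl φ) x := by
    rw [hW]; exact KStar.fderiv_curl_add_smul hV hφ s x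
  simp only [gainIntegrand, sd, zd, wd, e1, e2, e3, KStar.inner_apply_add_smul_expand, KStar.norm_add_smul_sq_expand,
    KStar.frobeniusNormSq_add_smul_expand, c1, c2, c3, z1, w1]
  ring

/-- **CUBIC STRUCTURE.** `locGain κ μ V (s•φ) = s·a₁ + s²·a₂ + s³·a₃` for smooth `V` and smooth compactly supported `φ`
(no integrability of `V`'s budgets needed: every coefficient is supported in `tsupport φ`). [folklore] -/
theorem locGain_smul (hV : ContDiff ℝ (⊤ : ℕ∞) V) (hφ : ContDiff ℝ (⊤ : ℕ∞) φ) (hφc : HasCompactSupport φ) (s : ℝ) :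
    locGain κ μ V (s • φ) = s * a1 κ μ V φ + s ^ 2 * a2 κ μ V φ + s ^ 3 * a3 φ := by
  have ic1 : Integrable (c1 V φ) := (KStar.integrable_stretching_coeffs hV hφ hφc).1
  have ic2 : Integrable (c2 V φ) := (KStar.integrable_stretching_coeffs hV hφ hφc).2.1
  have ic3 : Integrable (c3 φ) := (KStar.integrable_stretching_coeffs hV hφ hφc).2.2
  have iz1 : Integrable (z1 V φ) := (KStar.integrable_enstrophy_coeffs hV hφ hφc).1
  have izd : Integrable (zd φ) := (KStar.integrable_enstrophy_coeffs hV hφ hφc).2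
  have iw1 : Integrable (w1 V φ) := (KStar.integrable_palinstrophy_coeffs hV hφ hφc).1
  have iwd : Integrable (wd φ) := (KStar.integrable_palinstrophy_coeffs hV hφ hφc).2
  have i1 : Integrable (fun x => c1 V φ x - (κ / 2) * (μ⁻¹ * (2 * z1 V φ x) + μ * (2 * w1 V φ x))) :=
    ic1.sub ((((iz1.const_mul 2).const_mul μ⁻¹).add ((iw1.const_mul 2).const_mul μ)).const_mul (κ / 2))
  have i2 : Integrable (fun x => c2 V φ x - (κ / 2) * (μ⁻¹ * zd φ x + μ * wd φ x)) :=
    ic2.sub (((izd.const_mul μ⁻¹).add (iwd.const_mul μ)).const_mul (κ / 2))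
  have i1s : Integrable (fun x => s * (c1 V φ x - (κ / 2) * (μ⁻¹ * (2 * z1 V φ x) + μ * (2 * w1 V φ x)))) :=
    i1.const_mul s
  have i2s : Integrable (fun x => s ^ 2 * (c2 V φ x - (κ / 2) * (μ⁻¹ * zd φ x + μ * wd φ x))) := i2.const_mul _
  have i3s : Integrable (fun x => s ^ 3 * c3 φ x) := ic3.const_mul _
  have i12 : Integrable (fun x => s * (c1 V φ x - (κ / 2) * (μ⁻¹ * (2 * z1 V φ x) + μ * (2 * w1 V φ x))) +
      s ^ 2 * (c2 V φ x - (κ / 2) * (μ⁻¹ * zd φ x + μ * wd φ x))) := i1s.add i2s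
  have e0 : locGain κ μ V (s • φ) = ∫ x, (s * (c1 V φ x - (κ / 2) * (μ⁻¹ * (2 * z1 V φ x) + μ * (2 * w1 V φ x))) +
      s ^ 2 * (c2 V φ x - (κ / 2) * (μ⁻¹ * zd φ x + μ * wd φ x)) + s ^ 3 * c3 φ x) := by
    rw [locGain_eq_integral]; exact integral_congr_ae (Eventually.of_forall (gainIntegrand_smul hV hφ s))
  rw [e0, integral_add i12 i3s, integral_add i1s i2s, integral_const_mul, integral_const_mul, integral_const_mul]
  rfl

/-- If `s²·a₂ + s³·a₃ ≤ 0` for all `s ∈ (0,1]` then `a₂ ≤ 0`. [folklore] -/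
theorem coeff2_nonpos {p q s₀ : ℝ} (hs₀ : 0 < s₀) (h : ∀ s : ℝ, 0 < s → s ≤ s₀ → s ^ 2 * p + s ^ 3 * q ≤ 0) :
    p ≤ 0 := by
  by_contra hp
  push Not at hp
  set s : ℝ := min s₀ (p / (2 * (|q| + 1))) with hs
  have hq1 : 0 < |q| + 1 := by positivity
  have hs0 : 0 < s := lt_min hs₀ (div_pos hp (by positivity))
  have hs1 : s ≤ s₀ := min_le_left _ _
  have hs2 : s ≤ p / (2 * (|q| + 1)) := min_le_right _ _
  have h3 : -(s * |q|) ≤ s * q := by nlinarith [neg_abs_le q, hs0.le]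
  have h4 : s * |q| ≤ p / 2 := by
    have hfrac : |q| / (|q| + 1) ≤ 1 := by rw [div_le_one hq1]; linarith
    calc s * |q| ≤ p / (2 * (|q| + 1)) * |q| := by gcongr
      _ = (p / 2) * (|q| / (|q| + 1)) := by field_simp
      _ ≤ (p / 2) * 1 := by gcongr
      _ = p / 2 := mul_one _
  have h5 : 0 < p + s * q := by linarith
  have h6 : 0 < s ^ 2 * p + s ^ 3 * q := by
    have := mul_pos (pow_pos hs0 2) h5
    nlinarith [this]
  linarith [h s hs0 hs1]

/-- weighted stretching bulk `J_{χ²} = ∫ χ²·ξ`. -/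
def Jg (χ : E3 → ℝ) (V : E3 → E3) : ℝ := ∫ x, χ x ^ 2 * sd V x
/-- weighted quadratic bulk `K_{χ²} = (κ⋆/2)∫ χ²(|ω|² + |∇ω|²)`. -/
def Kg (χ : E3 → ℝ) (V : E3 → E3) : ℝ := kStar / 2 * ∫ x, χ x ^ 2 * (zd V x + wd V x)

/-- The weighted quadratic bulk is strictly positive as soon as the weight is `1` on a ball around a point of non-zero
vorticity. [folklore] -/
theorem Kg_pos {V : E3 → E3} {χ : E3 → ℝ} {y : E3} {r : ℝ} (hV : ContDiff ℝ (⊤ : ℕ∞) V) (hχ : Continuous χ)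
    (hχc : HasCompactSupport χ) (hr : 0 < r) (h1 : ∀ x ∈ Metric.ball y r, χ x = 1) (hy : curl V y ≠ 0) :
    0 < Kg χ V := by
  unfold Kg
  refine mul_pos (by have := kStar_pos; positivity) ?_
  set f : E3 → ℝ := fun x => χ x ^ 2 * (zd V x + wd V x) with hf
  have hnn : 0 ≤ f := fun x => by
    have h1' : 0 ≤ zd V x := by unfold zd; positivity
    have h2' : 0 ≤ wd V x := frobeniusNormSq_nonneg _
    show 0 ≤ χ x ^ 2 * (zd V x + wd V x)
    positivity
  have hcont : Continuous f := (hχ.pow 2).mul ((continuous_zd' hV).add (continuous_wd' hV))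
  have hsupp : HasCompactSupport f := by
    refine HasCompactSupport.intro hχc fun x hx => ?_
    show χ x ^ 2 * (zd V x + wd V x) = 0
    simp [image_eq_zero_of_notMem_tsupport hx]
  have hint : Integrable f := hcont.integrable_of_hasCompactSupport hsupp
  rw [integral_pos_iff_support_of_nonneg hnn hint]
  -- a small ball around `y` lies in the support
  have hcurl : Continuous (curl V) := continuous_curl (hV.of_le (by norm_cast))
  have hev : ∀ᶠ x in 𝓝 y, curl V x ≠ 0 := hcurl.continuousAt.eventually_ne hy
  obtain ⟨ρ, hρ, hρball⟩ := Metric.eventually_nhds_iff.1 hev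
  have hsub : Metric.ball y (min ρ r) ⊆ Function.support f := by
    intro x hx
    have hxρ : dist x y < ρ := lt_of_lt_of_le (Metric.mem_ball.1 hx) (min_le_left _ _)
    have hxr : x ∈ Metric.ball y r := Metric.mem_ball.2 (lt_of_lt_of_le (Metric.mem_ball.1 hx) (min_le_right _ _))
    have hne : curl V x ≠ 0 := hρball hxρ
    have hzd : 0 < zd V x := by unfold zd; positivity
    have hwd : 0 ≤ wd V x := frobeniusNormSq_nonneg _
    rw [Function.mem_support]
    show χ x ^ 2 * (zd V x + wd V x) ≠ 0
    rw [h1 x hxr]; positivity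
  exact lt_of_lt_of_le (Metric.measure_ball_pos volume y (lt_min hρ hr)) (measure_mono hsub)

/-- `curl η` is smooth for smooth `η`. [folklore] -/
theorem contDiff_curl_top {η : E3 → E3} (h : ContDiff ℝ (⊤ : ℕ∞) η) : ContDiff ℝ (⊤ : ℕ∞) (curl η) :=
  contDiff_curl (n := ⊤) (by simpa using h)

/-- `curl η` is divergence free for smooth `η`. [folklore] -/
theorem isDivFree_curl {η : E3 → E3} (h : ContDiff ℝ (⊤ : ℕ∞) η) : VectorCalculus.IsDivFree (curl η) :=
  fun x => divergence_curl_eq_zero_holds η (h.of_le (by norm_cast)) x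

/-! ## Two-sided tests off the contact set (port of §3c) -/

/-- If `t·p + t²·q + t³·w ≤ 0` for all `t ∈ (0, t₀]` then `p ≤ 0`. [folklore] -/
theorem coeff1_nonpos {p q w t₀ : ℝ} (ht₀ : 0 < t₀)
    (h : ∀ t : ℝ, 0 < t → t ≤ t₀ → t * p + t ^ 2 * q + t ^ 3 * w ≤ 0) : p ≤ 0 := by
  by_contra hp
  push Not at hp
  set S : ℝ := |q| + |w| + 1 with hS
  have hS0 : 0 < S := by positivity
  set t : ℝ := min t₀ (min 1 (p / (2 * S))) with ht
  have htpos : 0 < t := lt_min ht₀ (lt_min one_pos (div_pos hp (by positivity)))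
  have ht1 : t ≤ t₀ := min_le_left _ _
  have ht2 : t ≤ 1 := (min_le_right _ _).trans (min_le_left _ _)
  have ht3 : t ≤ p / (2 * S) := (min_le_right _ _).trans (min_le_right _ _)
  have hq : -(t ^ 2 * |q|) ≤ t ^ 2 * q := by nlinarith [neg_abs_le q, sq_nonneg t]
  have hw : -(t ^ 2 * |w|) ≤ t ^ 3 * w := by
    have h3 : t ^ 3 ≤ t ^ 2 := by nlinarith [sq_nonneg t, htpos.le]
    have : -(t ^ 3 * |w|) ≤ t ^ 3 * w := by nlinarith [neg_abs_le w, pow_pos htpos 3]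
    nlinarith [abs_nonneg w]
  have hmain : t * (|q| + |w|) ≤ p / 2 := by
    have hfrac : (|q| + |w|) / S ≤ 1 := by rw [div_le_one hS0]; linarith
    calc t * (|q| + |w|) ≤ p / (2 * S) * (|q| + |w|) := by gcongr
      _ = (p / 2) * ((|q| + |w|) / S) := by field_simp
      _ ≤ (p / 2) * 1 := by gcongr
      _ = p / 2 := mul_one _
  have hpos : 0 < t * p + t ^ 2 * q + t ^ 3 * w := by nlinarith [htpos, hq, hw, hmain]
  linarith [h t htpos ht1]

/-- If `t²·p + t³·q ≤ 0` for all `t ∈ (0, t₀]` then `p ≤ 0`. [folklore] -/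
theorem coeff2_nonpos' {p q t₀ : ℝ} (ht₀ : 0 < t₀)
    (h : ∀ t : ℝ, 0 < t → t ≤ t₀ → t ^ 2 * p + t ^ 3 * q ≤ 0) : p ≤ 0 := by
  refine coeff1_nonpos (q := q) (w := 0) ht₀ fun t ht ht' => ?_
  have h1 := h t ht ht'
  have h2 : t * (t * p + t ^ 2 * q + t ^ 3 * 0) ≤ t * 0 := by nlinarith [h1]
  exact le_of_mul_le_mul_left h2 ht

/-- `t • φ` is divergence free when `φ` is. [folklore] -/
theorem isDivFree_const_smul (hφ : ContDiff ℝ (⊤ : ℕ∞) φ) (hφdiv : VectorCalculus.IsDivFree φ) (t : ℝ) :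
    VectorCalculus.IsDivFree (t • φ) := by
  intro x
  have hφd : Differentiable ℝ φ := hφ.differentiable (by simp)
  have h0 : VectorCalculus.IsDivFree (fun _ : E3 => (0 : E3)) := by
    intro y; simp [VectorCalculus.divergence]
  have e : t • φ = fun y => (fun _ : E3 => (0 : E3)) y + t • φ y := by funext y; simp
  rw [e, KStar.divergence_add_smul (differentiable_const _) hφd t x, h0 x, hφdiv x]; ring

/-- STRICT SUPPORT ⇒ TWO-SIDED TESTS: if `‖V‖ < 1` on `tsupport φ`, then `t•φ` is a strict admissible test for all `|t| ≤ t₀`.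
[folklore] -/
theorem isTest_smul_of_strict (hV : ContDiff ℝ (⊤ : ℕ∞) V) (hφ : ContDiff ℝ (⊤ : ℕ∞) φ) (hφc : HasCompactSupport φ)
    (hφdiv : VectorCalculus.IsDivFree φ) (hstrict : ∀ x ∈ tsupport φ, ‖V x‖ < 1) :
    ∃ t₀ : ℝ, 0 < t₀ ∧ ∀ t : ℝ, |t| ≤ t₀ → IsTest V (t • φ) := by
  -- a uniform margin `m < 1` on the compact support
  have hm : ∃ m : ℝ, m < 1 ∧ ∀ x ∈ tsupport φ, ‖V x‖ ≤ m := by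
    by_cases hne : (tsupport φ).Nonempty
    · obtain ⟨x₀, hx₀, hmax⟩ := hφc.exists_isMaxOn hne (hV.continuous.norm.continuousOn)
      exact ⟨‖V x₀‖, hstrict x₀ hx₀, fun x hx => hmax hx⟩
    · exact ⟨0, one_pos, fun x hx => (hne ⟨x, hx⟩).elim⟩
  obtain ⟨m, hm1, hmb⟩ := hm
  obtain ⟨C, hC⟩ := hφ.continuous.bounded_above_of_compact_support hφc
  set C' : ℝ := |C| + 1 with hC'
  have hC'0 : 0 < C' := by positivity
  have hCb : ∀ x, ‖φ x‖ ≤ C' := fun x => (hC x).trans ((le_abs_self C).trans (by linarith))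
  refine ⟨(1 - m) / (2 * C'), div_pos (by linarith) (by positivity), fun t ht => ?_⟩
  refine ⟨hφ.const_smul t, ?_, isDivFree_const_smul hφ hφdiv t, fun x hx => ?_⟩
  · exact HasCompactSupport.intro hφc fun x hx => by simp [image_eq_zero_of_notMem_tsupport hx]
  · have hx' : x ∈ tsupport φ := tsupport_smul_subset_right (fun _ : E3 => t) φ hx
    have h1 : ‖V x + (t • φ) x‖ ≤ ‖V x‖ + |t| * ‖φ x‖ := by
      calc ‖V x + (t • φ) x‖ ≤ ‖V x‖ + ‖(t • φ) x‖ := norm_add_le _ _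
        _ = ‖V x‖ + |t| * ‖φ x‖ := by rw [Pi.smul_apply, norm_smul, Real.norm_eq_abs]
    have h2 : |t| * ‖φ x‖ ≤ (1 - m) / (2 * C') * C' := by gcongr; exact hCb x
    have h3 : (1 - m) / (2 * C') * C' = (1 - m) / 2 := by field_simp
    linarith [hmb x hx']

/-- Every strict test is a robust test (margin = its strictness margin on the compact `tsupport φ`), so a robust local
maximiser is a local maximiser in the strict sense. [folklore] -/
theorem isLocMax_of_isLocMaxIn (hV : ContDiff ℝ (⊤ : ℕ∞) V) (h : IsLocMaxIn κ μ V) : IsLocMax κ μ V := by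
  intro φ hφ
  obtain ⟨hφs, hφc, hφdiv, hstrict⟩ := hφ
  have hm : ∃ m : ℝ, m < 1 ∧ ∀ x ∈ tsupport φ, ‖V x + φ x‖ ≤ m := by
    by_cases hne : (tsupport φ).Nonempty
    · obtain ⟨x₀, hx₀, hmax⟩ :=
        hφc.exists_isMaxOn hne ((hV.continuous.add hφs.continuous).norm.continuousOn)
      exact ⟨‖V x₀ + φ x₀‖, hstrict x₀ hx₀, fun x hx => hmax hx⟩
    · exact ⟨0, one_pos, fun x hx => (hne ⟨x, hx⟩).elim⟩
  obtain ⟨m, hm1, hmb⟩ := hm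
  refine h (1 - m) φ (by linarith) ⟨hφs, hφc, hφdiv, fun x => ?_⟩
  by_cases hx : x ∈ tsupport φ
  · exact Or.inl (by linarith [hmb x hx])
  · exact Or.inr (by simp [image_eq_zero_of_notMem_tsupport hx])

/-- **FIRST AND SECOND ORDER OFF THE CONTACT SET (PROVED).**  A local maximiser is critical (`a₁ = 0`) and second-order maximal
(`a₂ ≤ 0`) along every smooth compactly supported divergence-free direction supported where `‖V‖ < 1`. -/
theorem firstSecondOrder_of_strict (hV : ContDiff ℝ (⊤ : ℕ∞) V) (hmax : IsLocMax κ μ V) (hφ : ContDiff ℝ (⊤ : ℕ∞) φ)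
    (hφc : HasCompactSupport φ) (hφdiv : VectorCalculus.IsDivFree φ) (hstrict : ∀ x ∈ tsupport φ, ‖V x‖ < 1) :
    a1 κ μ V φ = 0 ∧ a2 κ μ V φ ≤ 0 := by
  obtain ⟨t₀, ht₀, htest⟩ := isTest_smul_of_strict hV hφ hφc hφdiv hstrict
  have hle : ∀ t : ℝ, |t| ≤ t₀ → t * a1 κ μ V φ + t ^ 2 * a2 κ μ V φ + t ^ 3 * a3 φ ≤ 0 := fun t ht => by
    have h := hmax (t • φ) (htest t ht)
    rwa [locGain_smul hV hφ hφc t] at h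
  have h1 : a1 κ μ V φ ≤ 0 :=
    coeff1_nonpos ht₀ fun t ht ht' => hle t (by rwa [abs_of_pos ht])
  have h1' : -a1 κ μ V φ ≤ 0 := by
    refine coeff1_nonpos (q := a2 κ μ V φ) (w := -a3 φ) ht₀ fun t ht ht' => ?_
    have h := hle (-t) (by rwa [abs_neg, abs_of_pos ht])
    nlinarith [h]
  have ha1 : a1 κ μ V φ = 0 := by linarith
  refine ⟨ha1, coeff2_nonpos' (q := a3 φ) ht₀ fun t ht ht' => ?_⟩
  have h := hle t (by rwa [abs_of_pos ht])
  rw [ha1, mul_zero, zero_add] at h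
  exact h

/-- **EULER–LAGRANGE FOR DIM FIELDS (PROVED).**  If `‖V‖ < 1` everywhere, L4e's conclusion holds outright (and more: `a₂ ≤ 0` in
every direction — a dim local maximiser is a genuine two-sided second-order maximum). -/
theorem eulerLagrange_dim (hV : ContDiff ℝ (⊤ : ℕ∞) V) (hmax : IsLocMax κ μ V) (hdim : ∀ x, ‖V x‖ < 1) (φ : E3 → E3)
    (hφ : ContDiff ℝ (⊤ : ℕ∞) φ) (hφc : HasCompactSupport φ) (hφdiv : VectorCalculus.IsDivFree φ) :
    a1 κ μ V φ = 0 ∧ a2 κ μ V φ ≤ 0 :=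
  firstSecondOrder_of_strict hV hmax hφ hφc hφdiv fun x _ => hdim x


end Summit.NavierStokesRegularity.NavierStokesRegularity.Theorems.NearExtremalTransiencePerFlow.LocalMaximiser

end
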